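import Summits.RiemannHypothesis.RiemannHypothesis.Theorems.MotivicDoorCertPosConstrained

/-!
# Motivic door — CERTPOS gen 2: sharded class-witness check

[PROVED] The single kernel check `GramCert.classNegOK` (`numBound < 0`) of
`MotivicDoorCertPosConstrained` is split into row shards, exactly as `GramCert.valid_of_shards`
splits the LDLᵀ row check: `numRowsLE z (n·q) n (B q)` for `q < s` with `k = n·s` and
`Σ_{q<s} B q < 0` give `classNegOK z` (`classNegOK_of_shards`). One `decide +kernel` theorem per
shard keeps each kernel evaluation small (the unsharded check exhausts kernel memory at `k = 80`).
No new mathematics; pure bookkeeping over `Finset.range`.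

Honest framing (pub-rhdoor): lottery ticket at the motivic door; RH probability negligible; consolation
prizes are real: a new semi-local Weil-positivity theorem, or a located gap in the Connes–Consani
programme, plus the ff-door theorem.
-/

set_option linter.dupNamespace false  -- the mandated namespace repeats `RiemannHypothesis`

namespace Summit.RiemannHypothesis.RiemannHypothesis.Theorems.MotivicDoor.CertPos

namespace GramCert

variable (c : GramCert)

/-- PROVED: the row sums over `[0, n·s)` regroup into `s` consecutive shards of width `n`. [folklore] -/
theorem sum_range_mul_eq_sum_shards (f : ℕ → ℤ) (n s : ℕ) :
    ∑ i ∈ Finset.range (n * s), f i = ∑ q ∈ Finset.range s, ∑ i ∈ Finset.range n, f (n * q + i) := by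
  induction s with
  | zero => simp
  | succ s ih =>
      rw [Nat.mul_succ, Finset.sum_range_add, ih, Finset.sum_range_succ]

/-- **PROVED — SHARDED CLASS-WITNESS CHECK.** If the `s` shards of width `n` cover `[0, k)` exactly
(`k = n·s`), each shard's row sum is bounded by `B q` (`numRowsLE`, one kernel check per shard),
`Σ_{q<s} B q < 0` and `j < k`, then `classNegOK z` holds. [folklore] -/
theorem classNegOK_of_shards (z : ClassWitness) (n s : ℕ) (hcover : c.k = n * s) (B : ℕ → ℤ)
    (h : ∀ q < s, c.numRowsLE z (n * q) n (B q) = true)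
    (hsum : ∑ q ∈ Finset.range s, B q < 0) (hj : z.j < c.k) : c.classNegOK z = true := by
  simp only [GramCert.classNegOK, Bool.and_eq_true, decide_eq_true_eq]
  refine ⟨hj, ?_⟩
  have hNB : c.numBound z = ∑ q ∈ Finset.range s, ∑ i ∈ Finset.range n, c.numRow z (n * q + i) := by
    simp only [GramCert.numBound, hcover]
    exact sum_range_mul_eq_sum_shards _ n s
  have hle : c.numBound z ≤ ∑ q ∈ Finset.range s, B q := by
    rw [hNB]
    refine Finset.sum_le_sum fun q hq => ?_
    have hq' := h q (Finset.mem_range.mp hq)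
    simpa [GramCert.numRowsLE] using hq'
  exact lt_of_le_of_lt hle hsum

end GramCert

end Summit.RiemannHypothesis.RiemannHypothesis.Theorems.MotivicDoor.CertPos
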